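import Summits.Ventures.PercRepro.C041SeedCoverBase
import Summits.Ventures.PercRepro.C041StarBoundsTwo
import Summits.Ventures.PercRepro.C041StarBoundsThree
import Summits.Ventures.PercRepro.C041StarBoundsFour
import Summits.Ventures.PercRepro.C041SeedSlab240
import Summits.Ventures.PercRepro.C041SeedSlab241
import Summits.Ventures.PercRepro.C041SeedSlab250
import Summits.Ventures.PercRepro.C041SeedSlab251
import Summits.Ventures.PercRepro.C041SeedSlab300

/-!
# THE BRIDGE `9/2 ≤ P₁ ≤ 16` OF THE LAST SEED — box 0: `A ∈ [(0 : ℝ), (1 / 20 : ℝ)]`, `B ∈ [(0 : ℝ), (1 / 20 : ℝ)]`, `P₁ ∈ [(9 / 2 : ℝ), (9 : ℝ)]` (mine-3, gen 65; C-041.md §21 (az))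

The slab theorems `InCone_thetaTri_v1_slab240`, `InCone_thetaTri_v1_slab241`, `InCone_thetaTri_v1_slab250`, `InCone_thetaTri_v1_slab251`, `InCone_thetaTri_v1_slab300` assembled by a case split on `P₁`: for every star with `m ≥ 2` leaves whose invariants lie in the box,
`θ_△(v 1, V a) ∈ cone`.  Where a star sits above a slab's cap its `P₂` is lowered to the cap (`lower_hyps`, the monotonicity of
`C041SeedMonotone`); where the cap is the bound `A₀^{-1/2}` of `P₂² A ≤ 1` no lowering is needed.
-/

namespace PercRepro

namespace RelaxedTriangle

open TreeClosure

/-- Slab 240: the cap `(34 / 25 : ℝ)` satisfies the lower star bounds on the box × `[(9 / 2 : ℝ), ∞)`. -/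
theorem bridge0_cap_facts_240 (P1 A B : ℝ) (hA0 : (0 : ℝ) ≤ A) (hA1 : A ≤ (1 / 20 : ℝ)) (hB0 : (0 : ℝ) ≤ B) (hB1 : B ≤ (1 / 20 : ℝ)) (hP1a : (9 / 2 : ℝ) ≤ P1) :
    1 + B ^ 2 ≤ (34 / 25 : ℝ) ∧ 4 * B ≤ (34 / 25 : ℝ) ∧ 3 / 2 * (1 - A) ^ 2 ≤ P1 * ((34 / 25 : ℝ) - 1) ∧ 3 / 2 * (1 - B) ^ 2 ≤ (34 / 25 : ℝ) * (P1 - 1)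
      ∧ ((1 - A) * (1 - B)) ^ 2 ≤ (P1 - 1) * ((34 / 25 : ℝ) - 1) := by
  have hAq : (1 - A) ^ 2 ≤ (1 - (0 : ℝ)) ^ 2 := by nlinarith [mul_nonneg (sub_nonneg.2 hA0) (sub_nonneg.2 hA1)]
  have hBq : (1 - B) ^ 2 ≤ (1 - (0 : ℝ)) ^ 2 := by nlinarith [mul_nonneg (sub_nonneg.2 hB0) (sub_nonneg.2 hB1)]
  have hprod : ((1 - A) * (1 - B)) ^ 2 ≤ (1 - (0 : ℝ)) ^ 2 * (1 - (0 : ℝ)) ^ 2 := by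
    rw [mul_pow]; exact mul_le_mul hAq hBq (sq_nonneg _) (by positivity)
  refine ⟨?_, ?_, ?_, ?_, ?_⟩
  · nlinarith [mul_nonneg (sub_nonneg.2 hB0) (sub_nonneg.2 hB1)]
  · linarith
  · nlinarith [hAq, hP1a]
  · nlinarith [hBq, hP1a]
  · nlinarith [hprod, hP1a]

/-- Slab 241: the cap `(34 / 25 : ℝ)` satisfies the lower star bounds on the box × `[(21 / 4 : ℝ), ∞)`. -/
theorem bridge0_cap_facts_241 (P1 A B : ℝ) (hA0 : (0 : ℝ) ≤ A) (hA1 : A ≤ (1 / 20 : ℝ)) (hB0 : (0 : ℝ) ≤ B) (hB1 : B ≤ (1 / 20 : ℝ)) (hP1a : (21 / 4 : ℝ) ≤ P1) :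
    1 + B ^ 2 ≤ (34 / 25 : ℝ) ∧ 4 * B ≤ (34 / 25 : ℝ) ∧ 3 / 2 * (1 - A) ^ 2 ≤ P1 * ((34 / 25 : ℝ) - 1) ∧ 3 / 2 * (1 - B) ^ 2 ≤ (34 / 25 : ℝ) * (P1 - 1)
      ∧ ((1 - A) * (1 - B)) ^ 2 ≤ (P1 - 1) * ((34 / 25 : ℝ) - 1) := by
  have hAq : (1 - A) ^ 2 ≤ (1 - (0 : ℝ)) ^ 2 := by nlinarith [mul_nonneg (sub_nonneg.2 hA0) (sub_nonneg.2 hA1)]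
  have hBq : (1 - B) ^ 2 ≤ (1 - (0 : ℝ)) ^ 2 := by nlinarith [mul_nonneg (sub_nonneg.2 hB0) (sub_nonneg.2 hB1)]
  have hprod : ((1 - A) * (1 - B)) ^ 2 ≤ (1 - (0 : ℝ)) ^ 2 * (1 - (0 : ℝ)) ^ 2 := by
    rw [mul_pow]; exact mul_le_mul hAq hBq (sq_nonneg _) (by positivity)
  refine ⟨?_, ?_, ?_, ?_, ?_⟩
  · nlinarith [mul_nonneg (sub_nonneg.2 hB0) (sub_nonneg.2 hB1)]
  · linarith
  · nlinarith [hAq, hP1a]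
  · nlinarith [hBq, hP1a]
  · nlinarith [hprod, hP1a]

/-- Slab 250: the cap `(51 / 40 : ℝ)` satisfies the lower star bounds on the box × `[(6 : ℝ), ∞)`. -/
theorem bridge0_cap_facts_250 (P1 A B : ℝ) (hA0 : (0 : ℝ) ≤ A) (hA1 : A ≤ (1 / 20 : ℝ)) (hB0 : (0 : ℝ) ≤ B) (hB1 : B ≤ (1 / 20 : ℝ)) (hP1a : (6 : ℝ) ≤ P1) :
    1 + B ^ 2 ≤ (51 / 40 : ℝ) ∧ 4 * B ≤ (51 / 40 : ℝ) ∧ 3 / 2 * (1 - A) ^ 2 ≤ P1 * ((51 / 40 : ℝ) - 1) ∧ 3 / 2 * (1 - B) ^ 2 ≤ (51 / 40 : ℝ) * (P1 - 1)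
      ∧ ((1 - A) * (1 - B)) ^ 2 ≤ (P1 - 1) * ((51 / 40 : ℝ) - 1) := by
  have hAq : (1 - A) ^ 2 ≤ (1 - (0 : ℝ)) ^ 2 := by nlinarith [mul_nonneg (sub_nonneg.2 hA0) (sub_nonneg.2 hA1)]
  have hBq : (1 - B) ^ 2 ≤ (1 - (0 : ℝ)) ^ 2 := by nlinarith [mul_nonneg (sub_nonneg.2 hB0) (sub_nonneg.2 hB1)]
  have hprod : ((1 - A) * (1 - B)) ^ 2 ≤ (1 - (0 : ℝ)) ^ 2 * (1 - (0 : ℝ)) ^ 2 := by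
    rw [mul_pow]; exact mul_le_mul hAq hBq (sq_nonneg _) (by positivity)
  refine ⟨?_, ?_, ?_, ?_, ?_⟩
  · nlinarith [mul_nonneg (sub_nonneg.2 hB0) (sub_nonneg.2 hB1)]
  · linarith
  · nlinarith [hAq, hP1a]
  · nlinarith [hBq, hP1a]
  · nlinarith [hprod, hP1a]

/-- Slab 251: the cap `(51 / 40 : ℝ)` satisfies the lower star bounds on the box × `[(7 : ℝ), ∞)`. -/
theorem bridge0_cap_facts_251 (P1 A B : ℝ) (hA0 : (0 : ℝ) ≤ A) (hA1 : A ≤ (1 / 20 : ℝ)) (hB0 : (0 : ℝ) ≤ B) (hB1 : B ≤ (1 / 20 : ℝ)) (hP1a : (7 : ℝ) ≤ P1) :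
    1 + B ^ 2 ≤ (51 / 40 : ℝ) ∧ 4 * B ≤ (51 / 40 : ℝ) ∧ 3 / 2 * (1 - A) ^ 2 ≤ P1 * ((51 / 40 : ℝ) - 1) ∧ 3 / 2 * (1 - B) ^ 2 ≤ (51 / 40 : ℝ) * (P1 - 1)
      ∧ ((1 - A) * (1 - B)) ^ 2 ≤ (P1 - 1) * ((51 / 40 : ℝ) - 1) := by
  have hAq : (1 - A) ^ 2 ≤ (1 - (0 : ℝ)) ^ 2 := by nlinarith [mul_nonneg (sub_nonneg.2 hA0) (sub_nonneg.2 hA1)]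
  have hBq : (1 - B) ^ 2 ≤ (1 - (0 : ℝ)) ^ 2 := by nlinarith [mul_nonneg (sub_nonneg.2 hB0) (sub_nonneg.2 hB1)]
  have hprod : ((1 - A) * (1 - B)) ^ 2 ≤ (1 - (0 : ℝ)) ^ 2 * (1 - (0 : ℝ)) ^ 2 := by
    rw [mul_pow]; exact mul_le_mul hAq hBq (sq_nonneg _) (by positivity)
  refine ⟨?_, ?_, ?_, ?_, ?_⟩
  · nlinarith [mul_nonneg (sub_nonneg.2 hB0) (sub_nonneg.2 hB1)]
  · linarith
  · nlinarith [hAq, hP1a]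
  · nlinarith [hBq, hP1a]
  · nlinarith [hprod, hP1a]

/-- Slab 300: the cap `(303 / 250 : ℝ)` satisfies the lower star bounds on the box × `[(8 : ℝ), ∞)`. -/
theorem bridge0_cap_facts_300 (P1 A B : ℝ) (hA0 : (0 : ℝ) ≤ A) (hA1 : A ≤ (1 / 20 : ℝ)) (hB0 : (0 : ℝ) ≤ B) (hB1 : B ≤ (1 / 20 : ℝ)) (hP1a : (8 : ℝ) ≤ P1) :
    1 + B ^ 2 ≤ (303 / 250 : ℝ) ∧ 4 * B ≤ (303 / 250 : ℝ) ∧ 3 / 2 * (1 - A) ^ 2 ≤ P1 * ((303 / 250 : ℝ) - 1) ∧ 3 / 2 * (1 - B) ^ 2 ≤ (303 / 250 : ℝ) * (P1 - 1)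
      ∧ ((1 - A) * (1 - B)) ^ 2 ≤ (P1 - 1) * ((303 / 250 : ℝ) - 1) := by
  have hAq : (1 - A) ^ 2 ≤ (1 - (0 : ℝ)) ^ 2 := by nlinarith [mul_nonneg (sub_nonneg.2 hA0) (sub_nonneg.2 hA1)]
  have hBq : (1 - B) ^ 2 ≤ (1 - (0 : ℝ)) ^ 2 := by nlinarith [mul_nonneg (sub_nonneg.2 hB0) (sub_nonneg.2 hB1)]
  have hprod : ((1 - A) * (1 - B)) ^ 2 ≤ (1 - (0 : ℝ)) ^ 2 * (1 - (0 : ℝ)) ^ 2 := by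
    rw [mul_pow]; exact mul_le_mul hAq hBq (sq_nonneg _) (by positivity)
  refine ⟨?_, ?_, ?_, ?_, ?_⟩
  · nlinarith [mul_nonneg (sub_nonneg.2 hB0) (sub_nonneg.2 hB1)]
  · linarith
  · nlinarith [hAq, hP1a]
  · nlinarith [hBq, hP1a]
  · nlinarith [hprod, hP1a]

/-- **THE SEED ON BOX 0 OF THE BRIDGE** (slabs with the star bounds `4AB ≤ (1 − A − B)²`, `B ≤ (1 − A)²`, `A + B ≤ 1`). -/
theorem InCone_thetaTri_v1_V_bridge0 {m : ℕ} (a : Fin (m + 2) → ℝ) (ha : ∀ i, 0 ≤ a i ∧ a i ≤ 1)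
    (hA : (0 : ℝ) ≤ ∏ i, a i ∧ ∏ i, a i ≤ (1 / 20 : ℝ)) (hB : (0 : ℝ) ≤ ∏ i, (1 - a i) ∧ ∏ i, (1 - a i) ≤ (1 / 20 : ℝ))
    (hP : (9 / 2 : ℝ) ≤ ∏ i, (1 + a i ^ 2) ∧ ∏ i, (1 + a i ^ 2) ≤ (9 : ℝ)) :
    InCone (thetaTri (v 1) (V a)) := by
  obtain ⟨hA00, _⟩ := prod_unit_mem a ha
  have h1 := one_add_prod_sq_le a ha
  have h2 := one_add_prod_one_sub_sq_le a ha
  have h4A := four_mul_prod_le_prod_one_add_sq a ha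
  have h4B := four_mul_prod_one_sub_le_prod a ha
  have hR := sharp_R a ha
  have hRm := sharp_R_mirror a ha
  have hU := U_ineq a ha
  have hu1 := prod_one_add_sq_sq_mul_prod_one_sub_le_one a ha
  have hu2 := prod_one_add_one_sub_sq_sq_mul_prod_le_one a ha
  have hR2 := four_mul_prod_mul_prod_one_sub_le a ha
  have hB3 := prod_one_sub_le_sq_one_sub_prod a ha
  have hAB1 := prod_add_prod_one_sub_le_one a ha
  set P1 := ∏ i, (1 + a i ^ 2) with hP1d
  set P2 := ∏ i, (1 + (1 - a i) ^ 2) with hP2d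
  set A := ∏ i, a i with hAd
  set B := ∏ i, (1 - a i) with hBd
  obtain ⟨hA0, hA1⟩ := hA
  obtain ⟨hB0, hB1⟩ := hB
  rcases le_or_gt P1 (21 / 4 : ℝ) with hb0 | hb0
  · have hP1a : (9 / 2 : ℝ) ≤ P1 := hP.1
    have hP1b : P1 ≤ (21 / 4 : ℝ) := hb0
    obtain ⟨c2, c4B, cR, cRm, cU⟩ := bridge0_cap_facts_240 P1 A B hA0 hA1 hB0 hB1 hP1a
    obtain ⟨l2, l4, lR, lRm, lU, lu2⟩ := lower_hyps P1 P2 A B (34 / 25 : ℝ) hA00 (by norm_num) h2 h4B hR hRm hU hu2 c2 c4B cR cRm cU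
    exact InCone_thetaTri_v1_V_of_le a le_rfl (min_le_left _ _) (InCone_thetaTri_v1_slab240 P1 (min P2 (34 / 25 : ℝ)) A B hA0 hA1 hB0 hB1 hP1a hP1b (min_le_right _ _) h1 l2 h4A l4 lR lRm lU hu1 lu2 hR2 hB3 hAB1)
  · have hprev : (21 / 4 : ℝ) < P1 := hb0
    rcases le_or_gt P1 (6 : ℝ) with hb1 | hb1
    · have hP1a : (21 / 4 : ℝ) ≤ P1 := hprev.le
      have hP1b : P1 ≤ (6 : ℝ) := hb1
      obtain ⟨c2, c4B, cR, cRm, cU⟩ := bridge0_cap_facts_241 P1 A B hA0 hA1 hB0 hB1 hP1a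
      obtain ⟨l2, l4, lR, lRm, lU, lu2⟩ := lower_hyps P1 P2 A B (34 / 25 : ℝ) hA00 (by norm_num) h2 h4B hR hRm hU hu2 c2 c4B cR cRm cU
      exact InCone_thetaTri_v1_V_of_le a le_rfl (min_le_left _ _) (InCone_thetaTri_v1_slab241 P1 (min P2 (34 / 25 : ℝ)) A B hA0 hA1 hB0 hB1 hP1a hP1b (min_le_right _ _) h1 l2 h4A l4 lR lRm lU hu1 lu2 hR2 hB3 hAB1)
    · have hprev : (6 : ℝ) < P1 := hb1
      rcases le_or_gt P1 (7 : ℝ) with hb2 | hb2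
      · have hP1a : (6 : ℝ) ≤ P1 := hprev.le
        have hP1b : P1 ≤ (7 : ℝ) := hb2
        obtain ⟨c2, c4B, cR, cRm, cU⟩ := bridge0_cap_facts_250 P1 A B hA0 hA1 hB0 hB1 hP1a
        obtain ⟨l2, l4, lR, lRm, lU, lu2⟩ := lower_hyps P1 P2 A B (51 / 40 : ℝ) hA00 (by norm_num) h2 h4B hR hRm hU hu2 c2 c4B cR cRm cU
        exact InCone_thetaTri_v1_V_of_le a le_rfl (min_le_left _ _) (InCone_thetaTri_v1_slab250 P1 (min P2 (51 / 40 : ℝ)) A B hA0 hA1 hB0 hB1 hP1a hP1b (min_le_right _ _) h1 l2 h4A l4 lR lRm lU hu1 lu2 hR2 hB3 hAB1)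
      · have hprev : (7 : ℝ) < P1 := hb2
        rcases le_or_gt P1 (8 : ℝ) with hb3 | hb3
        · have hP1a : (7 : ℝ) ≤ P1 := hprev.le
          have hP1b : P1 ≤ (8 : ℝ) := hb3
          obtain ⟨c2, c4B, cR, cRm, cU⟩ := bridge0_cap_facts_251 P1 A B hA0 hA1 hB0 hB1 hP1a
          obtain ⟨l2, l4, lR, lRm, lU, lu2⟩ := lower_hyps P1 P2 A B (51 / 40 : ℝ) hA00 (by norm_num) h2 h4B hR hRm hU hu2 c2 c4B cR cRm cU
          exact InCone_thetaTri_v1_V_of_le a le_rfl (min_le_left _ _) (InCone_thetaTri_v1_slab251 P1 (min P2 (51 / 40 : ℝ)) A B hA0 hA1 hB0 hB1 hP1a hP1b (min_le_right _ _) h1 l2 h4A l4 lR lRm lU hu1 lu2 hR2 hB3 hAB1)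
        · have hprev : (8 : ℝ) < P1 := hb3
          have hP1a : (8 : ℝ) ≤ P1 := hprev.le
          have hP1b : P1 ≤ (9 : ℝ) := hP.2
          obtain ⟨c2, c4B, cR, cRm, cU⟩ := bridge0_cap_facts_300 P1 A B hA0 hA1 hB0 hB1 hP1a
          obtain ⟨l2, l4, lR, lRm, lU, lu2⟩ := lower_hyps P1 P2 A B (303 / 250 : ℝ) hA00 (by norm_num) h2 h4B hR hRm hU hu2 c2 c4B cR cRm cU
          exact InCone_thetaTri_v1_V_of_le a le_rfl (min_le_left _ _) (InCone_thetaTri_v1_slab300 P1 (min P2 (303 / 250 : ℝ)) A B hA0 hA1 hB0 hB1 hP1a hP1b (min_le_right _ _) h1 l2 h4A l4 lR lRm lU hu1 lu2 hR2 hB3 hAB1)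

end RelaxedTriangle

end PercRepro
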